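import Literature.Barriers.BirchSwinnertonDyer.RankNotSumOfLocalInvariantsK1Selmer
import Mathlib.NumberTheory.LegendreSymbol.QuadraticChar.Basic
import HarnessLib

/-!
# `rk E(F₄)` for `E = 480a1` via `ℚ(√-1)`, III: unit parts, digits and the local characters

Third groundwork file for the complete `2`-descents over `K1 = ℚ(√-1)`. For a prime `p` of
`ℤ[i]` every non-zero Gaussian integer is uniquely `p^m · u` with `p ∤ u` (`unitPart`); reading
the unit part `u` through a ring homomorphism `φ : ℤ[i] → A` killing `p` gives the "leading
`p`-adic digit", and composing with a `ℤ/2`-valued function multiplicative on the digits of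
`p`-units gives a square-class character (`MulBit.ofDigit`, an instance of the `MulBit`s of
file II). The characters of the four descents (Silverman AEC X.1: generators of the duals of the
local groups `K_v^×/K_v^{×2}` at the places `v ∈ S`):

* at the six split primes `2 ± i`, `5 ± 4i`, `8 ± 3i` (residue fields `𝔽₅`, `𝔽₄₁`, `𝔽₇₃`): the
  reduction maps `red5a, …, red73b : ℤ[i] →+* ZMod q` (`i ↦ 3, 2, 9, 32, 46, 27`), whose kernels
  are exactly the corresponding primes (`red*_eq_zero_iff`), and the **quadratic-residue bit**
  of the unit part (`qrBitZMod`, `MulBit.qr5a`, …);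
* at the ramified prime `1 + i` (completion `ℚ₂(√-1)`, whose unit group modulo squares is
  `(ℤ/2)³`, units being squares iff `≡ ±1 (mod (1+i)⁵)`): the reduction
  `red8 : ℤ[i] →+* R8 = (ℤ/8)[i]` and the three **dyadic bits** of the unit part `u = a + bi`
  (`a + b` odd): `re8 = [a even]`, `nrm8 = [a² + b² ≡ 5 (8)]`,
  `t8 = χ₈(a + b) + [a odd ∧ b ≡ 2 (4)]` (`MulBit.dyRe`, `MulBit.dyNrm`, `MulBit.dyT`), whose
  multiplicativity on odd residues is a finite check (`decide` over `(ℤ/8)⁴`).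

Everything is proved; the values of these characters on the generators `i, gen j` of `K1(S,2)`
are tabulated in the sequel.

## References

* J. H. Silverman, *The Arithmetic of Elliptic Curves*, 2nd ed., GTM 106 (2009), Ch. X §1
  (complete `2`-descent: the local square classes at the places of `S`). [SilvermanAEC2009]
* T. Dokchitser, V. Dokchitser, *A note on the Mordell–Weil rank modulo `n`*, J. Number Theory
  131 (2011) 1833–1839, arXiv:0910.4588, proof of Thm. 2. [DokchitserDokchitser2011RankModN]
-/

namespace Literature.Barriers.BirchSwinnertonDyer.DokchitserDokchitser2011

open QuadraticAlgebra

/-- Mathlib's Gaussian integers `ℤ√-1` (the notation `ℤ[i]` is local to Mathlib's file). -/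
local notation "ℤ[i]" => GaussianInt

/-! ### The unit part at a prime -/

section UnitPart

variable {p : ℤ[i]}

/-- **The `p`-unit part** of a Gaussian integer: `z = p ^ multiplicity p z * unitPart p z`
(Euclidean division, exact). [folklore] -/
noncomputable def unitPart (p z : ℤ[i]) : ℤ[i] := z / p ^ multiplicity p z

/-- `p^m · unitPart = z`. [folklore] -/
theorem pow_mul_unitPart (hp : Prime p) (z : ℤ[i]) :
    p ^ multiplicity p z * unitPart p z = z :=
  EuclideanDomain.mul_div_cancel' (pow_ne_zero _ hp.ne_zero) (pow_multiplicity_dvd p z)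

/-- `p` does not divide the unit part of a non-zero element. [folklore] -/
theorem not_dvd_unitPart (hp : Prime p) {z : ℤ[i]} (hz : z ≠ 0) : ¬ p ∣ unitPart p z := by
  obtain ⟨c, hc, hpc⟩ := exists_eq_pow_multiplicity_mul hp hz
  have h : p ^ multiplicity p z * unitPart p z = p ^ multiplicity p z * c :=
    (pow_mul_unitPart hp z).trans hc
  rw [mul_left_cancel₀ (pow_ne_zero _ hp.ne_zero) h]
  exact hpc

/-- **The unit part of an explicit decomposition** `z = p^m c`, `p ∤ c`, is `c`. [folklore] -/
theorem unitPart_eq_of_eq_pow_mul (hp : Prime p) {z c : ℤ[i]} {m : ℕ} (hc : ¬ p ∣ c)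
    (h : z = p ^ m * c) : unitPart p z = c := by
  have hz : z ≠ 0 := by
    rw [h]; exact mul_ne_zero (pow_ne_zero _ hp.ne_zero) (fun h0 => hc (h0 ▸ dvd_zero p))
  have key := pow_mul_unitPart hp z
  rw [multiplicity_eq_of_eq_pow_mul hp hc h] at key
  nth_rewrite 2 [h] at key
  exact mul_left_cancel₀ (pow_ne_zero _ hp.ne_zero) key

/-- The unit part of `p^m c` (`p ∤ c`) is `c`. [folklore] -/
theorem unitPart_pow_mul (hp : Prime p) {c : ℤ[i]} (hc : ¬ p ∣ c) (m : ℕ) :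
    unitPart p (p ^ m * c) = c :=
  unitPart_eq_of_eq_pow_mul hp hc rfl

/-- The unit part of an element not divisible by `p` is itself. [folklore] -/
theorem unitPart_of_not_dvd (hp : Prime p) {c : ℤ[i]} (hc : ¬ p ∣ c) : unitPart p c = c :=
  unitPart_eq_of_eq_pow_mul hp hc (m := 0) (by rw [pow_zero, one_mul])

/-- **The unit part is multiplicative.** [folklore] -/
theorem unitPart_mul (hp : Prime p) {z w : ℤ[i]} (hz : z ≠ 0) (hw : w ≠ 0) :
    unitPart p (z * w) = unitPart p z * unitPart p w := by
  refine unitPart_eq_of_eq_pow_mul hp (m := multiplicity p z + multiplicity p w)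
    (fun h => (hp.dvd_or_dvd h).elim (not_dvd_unitPart hp hz) (not_dvd_unitPart hp hw)) ?_
  nth_rewrite 1 [← pow_mul_unitPart hp z, ← pow_mul_unitPart hp w]
  ring

end UnitPart

/-! ### Characters from digits -/

namespace MulBit

/-- **The character attached to a digit map.** For a prime `p`, a ring homomorphism
`φ : ℤ[i] → A` and a function `ψ : A → ℤ/2` additive on the `φ`-images of products of
`p`-units, `z ↦ ψ (φ (unitPart p z))` is a `MulBit`. [folklore] -/
noncomputable def ofDigit (p : ℤ[i]) (hp : Prime p) {A : Type*} [CommRing A] (φ : ℤ[i] →+* A)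
    (ψ : A → ZMod 2)
    (hψ : ∀ c d : ℤ[i], ¬ p ∣ c → ¬ p ∣ d → ψ (φ (c * d)) = ψ (φ c) + ψ (φ d)) : MulBit where
  toFun z := ψ (φ (unitPart p z))
  map_mul' hz hw := by
    rw [unitPart_mul hp hz hw]
    exact hψ _ _ (not_dvd_unitPart hp hz) (not_dvd_unitPart hp hw)

/-- **Value of `ofDigit` on `p^m c`, `p ∤ c`**: `ψ (φ c)`. [folklore] -/
theorem ofDigit_pow_mul {p : ℤ[i]} (hp : Prime p) {A : Type*} [CommRing A] (φ : ℤ[i] →+* A)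
    (ψ : A → ZMod 2)
    (hψ : ∀ c d : ℤ[i], ¬ p ∣ c → ¬ p ∣ d → ψ (φ (c * d)) = ψ (φ c) + ψ (φ d))
    {c : ℤ[i]} (hc : ¬ p ∣ c) (m : ℕ) :
    ofDigit p hp φ ψ hψ (p ^ m * c) = ψ (φ c) := by
  show ψ (φ (unitPart p (p ^ m * c))) = ψ (φ c)
  rw [unitPart_pow_mul hp hc]

/-- Value of `ofDigit` on a `p`-unit `c`: `ψ (φ c)`. [folklore] -/
theorem ofDigit_of_not_dvd {p : ℤ[i]} (hp : Prime p) {A : Type*} [CommRing A] (φ : ℤ[i] →+* A)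
    (ψ : A → ZMod 2)
    (hψ : ∀ c d : ℤ[i], ¬ p ∣ c → ¬ p ∣ d → ψ (φ (c * d)) = ψ (φ c) + ψ (φ d))
    {c : ℤ[i]} (hc : ¬ p ∣ c) :
    ofDigit p hp φ ψ hψ c = ψ (φ c) := by
  show ψ (φ (unitPart p c)) = ψ (φ c)
  rw [unitPart_of_not_dvd hp hc]

end MulBit

/-! ### The split primes: reduction maps to `𝔽_q` and the quadratic-residue bit -/

/-- **The quadratic-residue bit** on `ℤ/q`: `1` on non-squares, `0` on squares (and on `0`).
[folklore] -/
noncomputable def qrBitZMod (q : ℕ) (a : ZMod q) : ZMod 2 :=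
  open scoped Classical in if IsSquare a then 0 else 1

/-- `qrBitZMod q a = 0 ↔ a` is a square. [folklore] -/
theorem qrBitZMod_eq_zero_iff {q : ℕ} (a : ZMod q) : qrBitZMod q a = 0 ↔ IsSquare a := by
  unfold qrBitZMod
  split_ifs with h
  · exact ⟨fun _ => h, fun _ => rfl⟩
  · exact ⟨fun h1 => absurd h1 one_ne_zero, fun h' => absurd h' h⟩

/-- `qrBitZMod q a = 1 ↔ a` is not a square. [folklore] -/
theorem qrBitZMod_eq_one_iff {q : ℕ} (a : ZMod q) : qrBitZMod q a = 1 ↔ ¬ IsSquare a := by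
  unfold qrBitZMod
  split_ifs with h
  · exact ⟨fun h0 => absurd h0.symm one_ne_zero, fun h' => absurd h h'⟩
  · exact ⟨fun _ => h, fun _ => rfl⟩

/-- `qrBitZMod` in terms of Mathlib's quadratic character (odd prime `q`). [folklore] -/
theorem qrBitZMod_eq_ite {q : ℕ} [Fact q.Prime] (a : ZMod q) :
    qrBitZMod q a = if quadraticChar (ZMod q) a = -1 then 1 else 0 := by
  by_cases h : IsSquare a
  · rw [(qrBitZMod_eq_zero_iff a).mpr h, if_neg]
    rw [quadraticChar_neg_one_iff_not_isSquare]; exact fun h' => h' h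
  · rw [(qrBitZMod_eq_one_iff a).mpr h, if_pos]
    rwa [quadraticChar_neg_one_iff_not_isSquare]

/-- **`qrBitZMod` is additive on non-zero residues** (multiplicativity of the Legendre symbol;
`q` an odd prime). [folklore] -/
theorem qrBitZMod_mul {q : ℕ} [Fact q.Prime] {a b : ZMod q} (ha : a ≠ 0)
    (hb : b ≠ 0) : qrBitZMod q (a * b) = qrBitZMod q a + qrBitZMod q b := by
  rw [qrBitZMod_eq_ite, qrBitZMod_eq_ite, qrBitZMod_eq_ite, map_mul]
  rcases quadraticChar_dichotomy ha with h1 | h1 <;>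
    rcases quadraticChar_dichotomy hb with h2 | h2 <;>
    simp [h1, h2]
  decide

section Split

/-- `5` is prime. [folklore] -/
instance K1.fact_prime_5 : Fact (Nat.Prime 5) := ⟨by norm_num⟩
/-- `41` is prime. [folklore] -/
instance K1.fact_prime_41 : Fact (Nat.Prime 41) := ⟨by norm_num⟩
/-- `73` is prime. [folklore] -/
instance K1.fact_prime_73 : Fact (Nat.Prime 73) := ⟨by norm_num⟩

/-- The reduction `ℤ[i] → ℤ/q` sending `i ↦ s` (`s² = -1`). [folklore] -/
def redHom (q : ℕ) (s : ZMod q) (hs : s * s = ((-1 : ℤ) : ZMod q)) : ℤ[i] →+* ZMod q :=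
  Zsqrtd.lift ⟨s, hs⟩

/-- `redHom` on `⟨a, b⟩` is `a + b s`. [folklore] -/
theorem redHom_mk (q : ℕ) (s : ZMod q) (hs : s * s = ((-1 : ℤ) : ZMod q)) (a b : ℤ) :
    redHom q s hs ⟨a, b⟩ = (a : ZMod q) + (b : ZMod q) * s := rfl

/-- **The kernel of a reduction map is the prime it kills**: if `p` is a prime of `ℤ[i]` with
`φ p = 0` for a ring homomorphism `φ` to a non-trivial ring, then `φ z = 0 ↔ p ∣ z`
(`(p)` is maximal in the PID `ℤ[i]`). [folklore] -/
theorem redHom_eq_zero_iff_of_prime {A : Type*} [CommRing A] [Nontrivial A] (φ : ℤ[i] →+* A)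
    {p : ℤ[i]} (hp : Prime p) (hφp : φ p = 0) (z : ℤ[i]) : φ z = 0 ↔ p ∣ z := by
  have hmax : (Ideal.span {p}).IsMaximal := PrincipalIdealRing.isMaximal_of_irreducible hp.irreducible
  have hle : Ideal.span {p} ≤ RingHom.ker φ := by
    rw [Ideal.span_le, Set.singleton_subset_iff]; exact hφp
  have hne : RingHom.ker φ ≠ ⊤ := RingHom.ker_ne_top φ
  have heq : RingHom.ker φ = Ideal.span {p} := (hmax.eq_of_le hne hle).symm
  rw [← RingHom.mem_ker, heq, Ideal.mem_span_singleton]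

/-- Reduction modulo `2 + i`: `i ↦ 3 ∈ 𝔽₅`. [folklore] -/
def red5a : ℤ[i] →+* ZMod 5 := redHom 5 3 (by decide)
/-- Reduction modulo `2 - i`: `i ↦ 2 ∈ 𝔽₅`. [folklore] -/
def red5b : ℤ[i] →+* ZMod 5 := redHom 5 2 (by decide)
/-- Reduction modulo `5 + 4i`: `i ↦ 9 ∈ 𝔽₄₁`. [folklore] -/
def red41a : ℤ[i] →+* ZMod 41 := redHom 41 9 (by decide)
/-- Reduction modulo `5 - 4i`: `i ↦ 32 ∈ 𝔽₄₁`. [folklore] -/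
def red41b : ℤ[i] →+* ZMod 41 := redHom 41 32 (by decide)
/-- Reduction modulo `8 + 3i`: `i ↦ 46 ∈ 𝔽₇₃`. [folklore] -/
def red73a : ℤ[i] →+* ZMod 73 := redHom 73 46 (by decide)
/-- Reduction modulo `8 - 3i`: `i ↦ 27 ∈ 𝔽₇₃`. [folklore] -/
def red73b : ℤ[i] →+* ZMod 73 := redHom 73 27 (by decide)

/-- `red5a ⟨a, b⟩ = a + 3b`. [folklore] -/
theorem red5a_mk (a b : ℤ) : red5a ⟨a, b⟩ = (a : ZMod 5) + (b : ZMod 5) * 3 := rfl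
/-- `red5b ⟨a, b⟩ = a + 2b`. [folklore] -/
theorem red5b_mk (a b : ℤ) : red5b ⟨a, b⟩ = (a : ZMod 5) + (b : ZMod 5) * 2 := rfl
/-- `red41a ⟨a, b⟩ = a + 9b`. [folklore] -/
theorem red41a_mk (a b : ℤ) : red41a ⟨a, b⟩ = (a : ZMod 41) + (b : ZMod 41) * 9 := rfl
/-- `red41b ⟨a, b⟩ = a + 32b`. [folklore] -/
theorem red41b_mk (a b : ℤ) : red41b ⟨a, b⟩ = (a : ZMod 41) + (b : ZMod 41) * 32 := rfl
/-- `red73a ⟨a, b⟩ = a + 46b`. [folklore] -/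
theorem red73a_mk (a b : ℤ) : red73a ⟨a, b⟩ = (a : ZMod 73) + (b : ZMod 73) * 46 := rfl
/-- `red73b ⟨a, b⟩ = a + 27b`. [folklore] -/
theorem red73b_mk (a b : ℤ) : red73b ⟨a, b⟩ = (a : ZMod 73) + (b : ZMod 73) * 27 := rfl

/-- `red5a z = 0 ↔ (2 + i) ∣ z`. [folklore] -/
theorem red5a_eq_zero_iff (z : ℤ[i]) : red5a z = 0 ↔ g5a ∣ z :=
  redHom_eq_zero_iff_of_prime red5a prime_g5a (by decide) z
/-- `red5b z = 0 ↔ (2 - i) ∣ z`. [folklore] -/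
theorem red5b_eq_zero_iff (z : ℤ[i]) : red5b z = 0 ↔ g5b ∣ z :=
  redHom_eq_zero_iff_of_prime red5b prime_g5b (by decide) z
/-- `red41a z = 0 ↔ (5 + 4i) ∣ z`. [folklore] -/
theorem red41a_eq_zero_iff (z : ℤ[i]) : red41a z = 0 ↔ g41a ∣ z :=
  redHom_eq_zero_iff_of_prime red41a prime_g41a (by decide) z
/-- `red41b z = 0 ↔ (5 - 4i) ∣ z`. [folklore] -/
theorem red41b_eq_zero_iff (z : ℤ[i]) : red41b z = 0 ↔ g41b ∣ z :=
  redHom_eq_zero_iff_of_prime red41b prime_g41b (by decide) z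
/-- `red73a z = 0 ↔ (8 + 3i) ∣ z`. [folklore] -/
theorem red73a_eq_zero_iff (z : ℤ[i]) : red73a z = 0 ↔ g73a ∣ z :=
  redHom_eq_zero_iff_of_prime red73a prime_g73a (by decide) z
/-- `red73b z = 0 ↔ (8 - 3i) ∣ z`. [folklore] -/
theorem red73b_eq_zero_iff (z : ℤ[i]) : red73b z = 0 ↔ g73b ∣ z :=
  redHom_eq_zero_iff_of_prime red73b prime_g73b (by decide) z

/-- **The quadratic-residue bit is additive on the digits of `p`-units** for a reduction map
whose kernel is `(p)`. [folklore] -/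
theorem qrBitZMod_redHom_mul {q : ℕ} [Fact q.Prime] (φ : ℤ[i] →+* ZMod q)
    {p : ℤ[i]} (hker : ∀ z, φ z = 0 ↔ p ∣ z) (c d : ℤ[i]) (hc : ¬ p ∣ c) (hd : ¬ p ∣ d) :
    qrBitZMod q (φ (c * d)) = qrBitZMod q (φ c) + qrBitZMod q (φ d) := by
  rw [map_mul]
  exact qrBitZMod_mul (fun h => hc ((hker c).mp h)) (fun h => hd ((hker d).mp h))

namespace MulBit

/-- **The quadratic-residue character at `2 + i`.** [folklore] -/
noncomputable def qr5a : MulBit :=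
  ofDigit g5a prime_g5a red5a (qrBitZMod 5) (qrBitZMod_redHom_mul _ red5a_eq_zero_iff)
/-- **The quadratic-residue character at `2 - i`.** [folklore] -/
noncomputable def qr5b : MulBit :=
  ofDigit g5b prime_g5b red5b (qrBitZMod 5) (qrBitZMod_redHom_mul _ red5b_eq_zero_iff)
/-- **The quadratic-residue character at `5 + 4i`.** [folklore] -/
noncomputable def qr41a : MulBit :=
  ofDigit g41a prime_g41a red41a (qrBitZMod 41)
    (qrBitZMod_redHom_mul _ red41a_eq_zero_iff)
/-- **The quadratic-residue character at `5 - 4i`.** [folklore] -/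
noncomputable def qr41b : MulBit :=
  ofDigit g41b prime_g41b red41b (qrBitZMod 41)
    (qrBitZMod_redHom_mul _ red41b_eq_zero_iff)
/-- **The quadratic-residue character at `8 + 3i`.** [folklore] -/
noncomputable def qr73a : MulBit :=
  ofDigit g73a prime_g73a red73a (qrBitZMod 73)
    (qrBitZMod_redHom_mul _ red73a_eq_zero_iff)
/-- **The quadratic-residue character at `8 - 3i`.** [folklore] -/
noncomputable def qr73b : MulBit :=
  ofDigit g73b prime_g73b red73b (qrBitZMod 73)
    (qrBitZMod_redHom_mul _ red73b_eq_zero_iff)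

/-- Value of `qr5a` on `(2+i)^m c`, `2+i ∤ c`. [folklore] -/
theorem qr5a_pow_mul {c : ℤ[i]} (hc : ¬ g5a ∣ c) (m : ℕ) :
    qr5a (g5a ^ m * c) = qrBitZMod 5 (red5a c) := ofDigit_pow_mul _ _ _ _ hc m
/-- Value of `qr5b` on `(2-i)^m c`, `2-i ∤ c`. [folklore] -/
theorem qr5b_pow_mul {c : ℤ[i]} (hc : ¬ g5b ∣ c) (m : ℕ) :
    qr5b (g5b ^ m * c) = qrBitZMod 5 (red5b c) := ofDigit_pow_mul _ _ _ _ hc m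
/-- Value of `qr41a` on `(5+4i)^m c`, `5+4i ∤ c`. [folklore] -/
theorem qr41a_pow_mul {c : ℤ[i]} (hc : ¬ g41a ∣ c) (m : ℕ) :
    qr41a (g41a ^ m * c) = qrBitZMod 41 (red41a c) := ofDigit_pow_mul _ _ _ _ hc m
/-- Value of `qr41b` on `(5-4i)^m c`, `5-4i ∤ c`. [folklore] -/
theorem qr41b_pow_mul {c : ℤ[i]} (hc : ¬ g41b ∣ c) (m : ℕ) :
    qr41b (g41b ^ m * c) = qrBitZMod 41 (red41b c) := ofDigit_pow_mul _ _ _ _ hc m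
/-- Value of `qr73a` on `(8+3i)^m c`, `8+3i ∤ c`. [folklore] -/
theorem qr73a_pow_mul {c : ℤ[i]} (hc : ¬ g73a ∣ c) (m : ℕ) :
    qr73a (g73a ^ m * c) = qrBitZMod 73 (red73a c) := ofDigit_pow_mul _ _ _ _ hc m
/-- Value of `qr73b` on `(8-3i)^m c`, `8-3i ∤ c`. [folklore] -/
theorem qr73b_pow_mul {c : ℤ[i]} (hc : ¬ g73b ∣ c) (m : ℕ) :
    qr73b (g73b ^ m * c) = qrBitZMod 73 (red73b c) := ofDigit_pow_mul _ _ _ _ hc m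

/-- Value of `qr5a` on a `(2+i)`-unit. [folklore] -/
theorem qr5a_of_not_dvd {c : ℤ[i]} (hc : ¬ g5a ∣ c) : qr5a c = qrBitZMod 5 (red5a c) :=
  ofDigit_of_not_dvd _ _ _ _ hc
/-- Value of `qr5b` on a `(2-i)`-unit. [folklore] -/
theorem qr5b_of_not_dvd {c : ℤ[i]} (hc : ¬ g5b ∣ c) : qr5b c = qrBitZMod 5 (red5b c) :=
  ofDigit_of_not_dvd _ _ _ _ hc
/-- Value of `qr41a` on a `(5+4i)`-unit. [folklore] -/
theorem qr41a_of_not_dvd {c : ℤ[i]} (hc : ¬ g41a ∣ c) : qr41a c = qrBitZMod 41 (red41a c) :=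
  ofDigit_of_not_dvd _ _ _ _ hc
/-- Value of `qr41b` on a `(5-4i)`-unit. [folklore] -/
theorem qr41b_of_not_dvd {c : ℤ[i]} (hc : ¬ g41b ∣ c) : qr41b c = qrBitZMod 41 (red41b c) :=
  ofDigit_of_not_dvd _ _ _ _ hc
/-- Value of `qr73a` on a `(8+3i)`-unit. [folklore] -/
theorem qr73a_of_not_dvd {c : ℤ[i]} (hc : ¬ g73a ∣ c) : qr73a c = qrBitZMod 73 (red73a c) :=
  ofDigit_of_not_dvd _ _ _ _ hc
/-- Value of `qr73b` on a `(8-3i)`-unit. [folklore] -/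
theorem qr73b_of_not_dvd {c : ℤ[i]} (hc : ¬ g73b ∣ c) : qr73b c = qrBitZMod 73 (red73b c) :=
  ofDigit_of_not_dvd _ _ _ _ hc

end MulBit

end Split

/-! ### The ramified prime `1 + i`: residues modulo `8` and the three dyadic bits -/

section Dyadic

/-- The ring `(ℤ/8)[i] = ℤ[i]/(8) = ℤ[i]/(1+i)⁶`. [folklore] -/
abbrev R8 : Type := QuadraticAlgebra (ZMod 8) (-1) 0

/-- In `R8`: `ω² = -1`. [folklore] -/
theorem R8.omega_mul_omega : (ω : R8) * ω = ((-1 : ℤ) : R8) := by decide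

/-- **Reduction modulo `8`**: `ℤ[i] → (ℤ/8)[i]`. [folklore] -/
def red8 : ℤ[i] →+* R8 := Zsqrtd.lift ⟨ω, R8.omega_mul_omega⟩

/-- `red8 z = z.re + z.im ω`. [folklore] -/
theorem red8_apply (z : ℤ[i]) : red8 z = (z.re : R8) + (z.im : R8) * ω := rfl

/-- `red8 ⟨a, b⟩ = ⟨a, b⟩ (mod 8)`. [folklore] -/
theorem red8_mk (a b : ℤ) : red8 ⟨a, b⟩ = (⟨(a : ZMod 8), (b : ZMod 8)⟩ : R8) := by
  ext <;> simp [red8_apply, omega_re, omega_im]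

/-- Real coordinate of `red8 z`. [folklore] -/
theorem red8_re (z : ℤ[i]) : (red8 z).re = (z.re : ZMod 8) := by
  obtain ⟨a, b⟩ := z; rw [red8_mk]

/-- Imaginary coordinate of `red8 z`. [folklore] -/
theorem red8_im (z : ℤ[i]) : (red8 z).im = (z.im : ZMod 8) := by
  obtain ⟨a, b⟩ := z; rw [red8_mk]

/-- **Odd residues**: `u ∈ R8` with `u.re + u.im` odd — the images of the `(1+i)`-units.
[folklore] -/
def R8.OddPat (u : R8) : Prop :=
  u.re + u.im = 1 ∨ u.re + u.im = 3 ∨ u.re + u.im = 5 ∨ u.re + u.im = 7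

/-- `R8.OddPat` is decidable. [folklore] -/
instance (u : R8) : Decidable (R8.OddPat u) := by unfold R8.OddPat; infer_instance

/-- An element of `ℤ/8` is `1, 3, 5` or `7` iff it is the class of an odd integer. [folklore] -/
theorem ZMod8.odd_iff (k : ℤ) :
    ((k : ZMod 8) = 1 ∨ (k : ZMod 8) = 3 ∨ (k : ZMod 8) = 5 ∨ (k : ZMod 8) = 7) ↔ ¬ (2 : ℤ) ∣ k := by
  have h8 : ((k % 8 : ℤ) : ZMod 8) = (k : ZMod 8) := ZMod.intCast_mod k 8
  rw [← h8]
  have hk : 0 ≤ k % 8 := Int.emod_nonneg k (by norm_num)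
  have hk' : k % 8 < 8 := Int.emod_lt_of_pos k (by norm_num)
  have hdvd : (2 : ℤ) ∣ k ↔ (2 : ℤ) ∣ k % 8 := by omega
  rw [hdvd]
  generalize k % 8 = r at hk hk' ⊢
  interval_cases r <;> decide

/-- **`1 + i ∣ z ↔ z.re + z.im` is even.** [folklore] -/
theorem g2_dvd_iff (z : ℤ[i]) : g2 ∣ z ↔ (2 : ℤ) ∣ z.re + z.im := by
  constructor
  · rintro ⟨w, rfl⟩
    refine ⟨w.re, ?_⟩
    simp only [g2, Zsqrtd.re_mul, Zsqrtd.im_mul]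
    ring
  · rintro ⟨k, hk⟩
    refine ⟨⟨k, k - z.re⟩, Zsqrtd.ext ?_ ?_⟩
    · simp only [g2, Zsqrtd.re_mul]; ring
    · simp only [g2, Zsqrtd.im_mul]; linarith

/-- **`red8 z` is an odd residue iff `1 + i ∤ z`.** [folklore] -/
theorem oddPat_red8_iff (z : ℤ[i]) : R8.OddPat (red8 z) ↔ ¬ g2 ∣ z := by
  rw [R8.OddPat, red8_re, red8_im, ← Int.cast_add, ZMod8.odd_iff, g2_dvd_iff]

/-- `χ₈` on `ℤ/8`: `1` on `3, 5`, else `0`. [folklore] -/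
def chi8Z (r : ZMod 8) : ZMod 2 := if r = 3 ∨ r = 5 then 1 else 0

/-- **The dyadic bit `re`**: `1` iff the real part is even. [folklore] -/
def re8 (u : R8) : ZMod 2 := if u.re = 0 ∨ u.re = 2 ∨ u.re = 4 ∨ u.re = 6 then 1 else 0

/-- **The dyadic bit `nrm`**: `1` iff the norm `re² + im²` is `5 (mod 8)`. [folklore] -/
def nrm8 (u : R8) : ZMod 2 := if u.re ^ 2 + u.im ^ 2 = 5 then 1 else 0

/-- **The dyadic bit `t`**: `χ₈(re + im) + [re odd ∧ im ≡ 2 (mod 4)]`. [folklore] -/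
def t8 (u : R8) : ZMod 2 :=
  chi8Z (u.re + u.im) +
    (if (u.re = 1 ∨ u.re = 3 ∨ u.re = 5 ∨ u.re = 7) ∧ (u.im = 2 ∨ u.im = 6) then 1 else 0)

/-- Every element of `R8` is `⟨a, b⟩`. [folklore] -/
theorem R8.eq_mk (u : R8) : u = ⟨u.re, u.im⟩ := rfl

set_option maxRecDepth 8000 in
/-- `re8` is additive on products of odd residues (finite check). [folklore] -/
theorem re8_mul_mk : ∀ a b c d : ZMod 8, R8.OddPat ⟨a, b⟩ → R8.OddPat ⟨c, d⟩ →
    re8 ((⟨a, b⟩ : R8) * ⟨c, d⟩) = re8 ⟨a, b⟩ + re8 ⟨c, d⟩ := by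
  decide

set_option maxRecDepth 8000 in
/-- `nrm8` is additive on products of odd residues (finite check). [folklore] -/
theorem nrm8_mul_mk : ∀ a b c d : ZMod 8, R8.OddPat ⟨a, b⟩ → R8.OddPat ⟨c, d⟩ →
    nrm8 ((⟨a, b⟩ : R8) * ⟨c, d⟩) = nrm8 ⟨a, b⟩ + nrm8 ⟨c, d⟩ := by
  decide

set_option maxRecDepth 8000 in
/-- `t8` is additive on products of odd residues (finite check). [folklore] -/
theorem t8_mul_mk : ∀ a b c d : ZMod 8, R8.OddPat ⟨a, b⟩ → R8.OddPat ⟨c, d⟩ →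
    t8 ((⟨a, b⟩ : R8) * ⟨c, d⟩) = t8 ⟨a, b⟩ + t8 ⟨c, d⟩ := by
  decide

/-- `re8` is additive on products of odd residues. [folklore] -/
theorem re8_mul {u v : R8} (hu : R8.OddPat u) (hv : R8.OddPat v) :
    re8 (u * v) = re8 u + re8 v :=
  re8_mul_mk u.re u.im v.re v.im hu hv

/-- `nrm8` is additive on products of odd residues. [folklore] -/
theorem nrm8_mul {u v : R8} (hu : R8.OddPat u) (hv : R8.OddPat v) :
    nrm8 (u * v) = nrm8 u + nrm8 v :=
  nrm8_mul_mk u.re u.im v.re v.im hu hv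

/-- `t8` is additive on products of odd residues. [folklore] -/
theorem t8_mul {u v : R8} (hu : R8.OddPat u) (hv : R8.OddPat v) :
    t8 (u * v) = t8 u + t8 v :=
  t8_mul_mk u.re u.im v.re v.im hu hv

/-- Additivity of a dyadic bit on the digits of `(1+i)`-units. [folklore] -/
theorem dyadic_mul_of_oddPat {ψ : R8 → ZMod 2}
    (hψ : ∀ {u v : R8}, R8.OddPat u → R8.OddPat v → ψ (u * v) = ψ u + ψ v)
    (c d : ℤ[i]) (hc : ¬ g2 ∣ c) (hd : ¬ g2 ∣ d) :
    ψ (red8 (c * d)) = ψ (red8 c) + ψ (red8 d) := by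
  rw [map_mul]
  exact hψ ((oddPat_red8_iff c).mpr hc) ((oddPat_red8_iff d).mpr hd)

namespace MulBit

/-- **The dyadic character `re`** of the `(1+i)`-unit part. [folklore] -/
noncomputable def dyRe : MulBit :=
  ofDigit g2 prime_g2 red8 re8 (dyadic_mul_of_oddPat (fun hu hv => re8_mul hu hv))
/-- **The dyadic character `nrm`** of the `(1+i)`-unit part. [folklore] -/
noncomputable def dyNrm : MulBit :=
  ofDigit g2 prime_g2 red8 nrm8 (dyadic_mul_of_oddPat (fun hu hv => nrm8_mul hu hv))
/-- **The dyadic character `t`** of the `(1+i)`-unit part. [folklore] -/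
noncomputable def dyT : MulBit :=
  ofDigit g2 prime_g2 red8 t8 (dyadic_mul_of_oddPat (fun hu hv => t8_mul hu hv))

/-- Value of `dyRe` on `(1+i)^m c`, `1+i ∤ c`. [folklore] -/
theorem dyRe_pow_mul {c : ℤ[i]} (hc : ¬ g2 ∣ c) (m : ℕ) : dyRe (g2 ^ m * c) = re8 (red8 c) :=
  ofDigit_pow_mul _ _ _ _ hc m
/-- Value of `dyNrm` on `(1+i)^m c`, `1+i ∤ c`. [folklore] -/
theorem dyNrm_pow_mul {c : ℤ[i]} (hc : ¬ g2 ∣ c) (m : ℕ) : dyNrm (g2 ^ m * c) = nrm8 (red8 c) :=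
  ofDigit_pow_mul _ _ _ _ hc m
/-- Value of `dyT` on `(1+i)^m c`, `1+i ∤ c`. [folklore] -/
theorem dyT_pow_mul {c : ℤ[i]} (hc : ¬ g2 ∣ c) (m : ℕ) : dyT (g2 ^ m * c) = t8 (red8 c) :=
  ofDigit_pow_mul _ _ _ _ hc m

/-- Value of `dyRe` on a `(1+i)`-unit. [folklore] -/
theorem dyRe_of_not_dvd {c : ℤ[i]} (hc : ¬ g2 ∣ c) : dyRe c = re8 (red8 c) :=
  ofDigit_of_not_dvd _ _ _ _ hc
/-- Value of `dyNrm` on a `(1+i)`-unit. [folklore] -/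
theorem dyNrm_of_not_dvd {c : ℤ[i]} (hc : ¬ g2 ∣ c) : dyNrm c = nrm8 (red8 c) :=
  ofDigit_of_not_dvd _ _ _ _ hc
/-- Value of `dyT` on a `(1+i)`-unit. [folklore] -/
theorem dyT_of_not_dvd {c : ℤ[i]} (hc : ¬ g2 ∣ c) : dyT c = t8 (red8 c) :=
  ofDigit_of_not_dvd _ _ _ _ hc

end MulBit

end Dyadic

end Literature.Barriers.BirchSwinnertonDyer.DokchitserDokchitser2011
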